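import Summits.CriticalPhenomena.PercolationContinuityZ3.Theorems.Transplant.SkelPhiParaCorridorKG
import Summits.CriticalPhenomena.PercolationContinuityZ3.Theorems.Transplant.SkelPhiRootBridgeGeom
import HarnessLib

/-!
# N2 (frames-only node `SamePDropOfSkeletonFrm₁`, OPEN), (R) column: **THE CROSS LINK `hx` FROM FOUR NUMERIC ROWS** —
# `Skelφ.runX_mem_kgCorrSched_core_zero_of_rootFrame`

The row `hx` of the root skeletons (`NegB.rootLegAt_frmQ3C_fst` p354138 / `…Q3D_snd` p356852): a vertex whose root-frame reading
`rootFrame φ t 1 w` lies in a box `[lo, hi]` (the bridge's core-1 box) is read by the run frame `runX φ c₁ n h 1` inside the K-G corridor's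
start core `core 0 = [−q, q] × [−(⌊nℓ/U⌋ + 1 + W), ⌊nℓ/U⌋ + 1 + W]` (`mem_kgCorrSched_core_zero`), PROVIDED the landing vertex's exact offset
`(X₁, Y₁) := φ c₁ − φ t` satisfies: along, `X₁ − q ≤ lo 0` and `hi 0 ≤ X₁ + q` (coordinate 0 is EXACT: `runX … w 0 = φ w 0 − φ c₁ 0`); across, the
four CORNER rows `−(P+W)·U ≤ n·(lo 1 − Y₁) − h·(x₀ − X₁)` and `n·(hi 1 − Y₁) − h·(x₀ − X₁) ≤ (P+W)·U` for `x₀ ∈ {lo 0, hi 0}` (coordinate 1 is the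
floor `⌊(n·Δy − h·Δx)/U⌋`, `U = n + |h|`, affine in `Δx` so the corners suffice).  Cell-free (unaffected by the (R-40) T port); for stmt's
landing lemma ((R-37) placement).
builds on p205010 (kernel theorem, internal audit signed; external expert review pending) — nothing in this file uses p205010; nothing here is a claim
about the open node `SamePDropOfSkeletonFrm₁`.
Lane `prim-bschramm`, seat `prim-bschramm-p3` (gen 16; N2 design owner, (R) column owner); helper file (`--supports stmt-CriticalPhenomena-4575 --as helper`).
[cite: KozmaNitzan2024, §4 Lemma 11 (p. 22), Lemma 12 (pp. 23–25)] [cite: MartineauTassion2017, §3.2]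
-/

noncomputable section

namespace Summit.CriticalPhenomena.PercolationContinuityZ3.Theorems

namespace Transplant

namespace Skelφ

open Literature.Probability.Percolation Literature.Probability.LatticeModels SimpleGraph
open ChainPlanar ChainPara

variable {V : Type} {φ : V → Site 2}

variable {n ℓ : ℕ} {h v : ℤ} {R' ρ q W N m₁ Wm₂ Wp₂ m₂ : ℕ}
  (hP₁ : ParkOK (kgPark₁ n ℓ h v R' ρ q W N m₁)) (hP₂ : ParkOK (kgPark₂ n ℓ h v R' ρ q W N m₁ Wm₂ Wp₂ m₂))
  (hsplit : (Wm₂ : ℤ) + Wp₂ = (kgPark₁ n ℓ h v R' ρ q W N m₁).aHi (m₁ + 1) - ParkPrm.aLo (kgPark₁ n ℓ h v R' ρ q W N m₁) (m₁ + 1))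

include hP₁ hP₂ hsplit in
/-- **THE CROSS LINK FROM FOUR NUMERIC ROWS** (see the module docstring). [cite: KozmaNitzan2024, §4 Lemma 11 (p. 22)] -/
theorem runX_mem_kgCorrSched_core_zero_of_rootFrame (hn : 1 ≤ n) (t c₁ : V) {X₁ Y₁ : ℤ} (hX : φ c₁ 0 - φ t 0 = X₁) (hY : φ c₁ 1 - φ t 1 = Y₁)
    {lo hi : Site 2} (hx0 : X₁ - q ≤ lo 0) (hx1 : hi 0 ≤ X₁ + q)
    (hs₁ : -((((n * ℓ / shearUnit n h + 1 + W : ℕ) : ℤ)) * (shearUnit n h : ℤ)) ≤ (n : ℤ) * (lo 1 - Y₁) - h * (lo 0 - X₁))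
    (hs₂ : -((((n * ℓ / shearUnit n h + 1 + W : ℕ) : ℤ)) * (shearUnit n h : ℤ)) ≤ (n : ℤ) * (lo 1 - Y₁) - h * (hi 0 - X₁))
    (hs₃ : (n : ℤ) * (hi 1 - Y₁) - h * (lo 0 - X₁) ≤ ((n * ℓ / shearUnit n h + 1 + W : ℕ) : ℤ) * (shearUnit n h : ℤ))
    (hs₄ : (n : ℤ) * (hi 1 - Y₁) - h * (hi 0 - X₁) ≤ ((n * ℓ / shearUnit n h + 1 + W : ℕ) : ℤ) * (shearUnit n h : ℤ))
    {w : V} (hw : rootFrame φ t 1 w ∈ Finset.Icc lo hi) :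
    runX φ c₁ n h 1 w ∈ (kgCorrSched hP₁ hP₂ hsplit).core 0 := by
  have hU : 0 < (shearUnit n h : ℤ) := shearUnit_pos hn h
  obtain ⟨hlo, hhi⟩ := Finset.mem_Icc.1 hw
  have h0lo : lo 0 ≤ φ w 0 - φ t 0 := by
    have := hlo 0
    change lo 0 ≤ (if (0 : Fin 2) = 0 then (1 : ℤ) * (φ w 0 - φ t 0) else φ w 1 - φ t 1) at this
    rwa [if_pos rfl, one_mul] at this
  have h0hi : φ w 0 - φ t 0 ≤ hi 0 := by
    have := hhi 0
    change (if (0 : Fin 2) = 0 then (1 : ℤ) * (φ w 0 - φ t 0) else φ w 1 - φ t 1) ≤ hi 0 at this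
    rwa [if_pos rfl, one_mul] at this
  have h1lo : lo 1 ≤ φ w 1 - φ t 1 := by
    have := hlo 1
    change lo 1 ≤ (if (1 : Fin 2) = 0 then (1 : ℤ) * (φ w 0 - φ t 0) else φ w 1 - φ t 1) at this
    rwa [if_neg (by decide)] at this
  have h1hi : φ w 1 - φ t 1 ≤ hi 1 := by
    have := hhi 1
    change (if (1 : Fin 2) = 0 then (1 : ℤ) * (φ w 0 - φ t 0) else φ w 1 - φ t 1) ≤ hi 1 at this
    rwa [if_neg (by decide)] at this
  rw [mem_kgCorrSched_core_zero hP₁ hP₂ hsplit, runX_zero, runX_one, relCoord_apply, shearCoord_apply, one_mul, one_mul]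
  -- the along coordinate is exact
  refine ⟨⟨by linarith, by linarith⟩, ?_⟩
  -- the across coordinate: the shear sum lies between the corner values
  set Δx : ℤ := φ w 0 - φ c₁ 0 with hΔx
  set Δy : ℤ := φ w 1 - φ c₁ 1 with hΔy
  have hΔx_lo : lo 0 - X₁ ≤ Δx := by rw [hΔx]; linarith
  have hΔx_hi : Δx ≤ hi 0 - X₁ := by rw [hΔx]; linarith
  have hΔy_lo : lo 1 - Y₁ ≤ Δy := by rw [hΔy]; linarith
  have hΔy_hi : Δy ≤ hi 1 - Y₁ := by rw [hΔy]; linarith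
  have hn0 : (0 : ℤ) ≤ n := by positivity
  -- `−h·Δx` between the two corner values
  have hhx : min (-(h * (lo 0 - X₁))) (-(h * (hi 0 - X₁))) ≤ -(h * Δx) ∧ -(h * Δx) ≤ max (-(h * (lo 0 - X₁))) (-(h * (hi 0 - X₁))) := by
    rcases le_total 0 h with hh | hh
    · have a := mul_le_mul_of_nonneg_left hΔx_lo hh
      have b := mul_le_mul_of_nonneg_left hΔx_hi hh
      exact ⟨(min_le_right _ _).trans (by linarith), le_trans (by linarith) (le_max_left _ _)⟩
    · have a := mul_le_mul_of_nonpos_left hΔx_lo hh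
      have b := mul_le_mul_of_nonpos_left hΔx_hi hh
      exact ⟨(min_le_left _ _).trans (by linarith), le_trans (by linarith) (le_max_right _ _)⟩
  have hny_lo : (n : ℤ) * (lo 1 - Y₁) ≤ n * Δy := mul_le_mul_of_nonneg_left hΔy_lo hn0
  have hny_hi : (n : ℤ) * Δy ≤ n * (hi 1 - Y₁) := mul_le_mul_of_nonneg_left hΔy_hi hn0
  have hlow : -((((n * ℓ / shearUnit n h + 1 + W : ℕ) : ℤ)) * (shearUnit n h : ℤ)) ≤ (n : ℤ) * Δy - h * Δx := by
    have hm : -((((n * ℓ / shearUnit n h + 1 + W : ℕ) : ℤ)) * (shearUnit n h : ℤ)) ≤ (n : ℤ) * (lo 1 - Y₁) + min (-(h * (lo 0 - X₁))) (-(h * (hi 0 - X₁))) := by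
      rcases min_choice (-(h * (lo 0 - X₁))) (-(h * (hi 0 - X₁))) with e | e <;> rw [e] <;> linarith
    linarith [hhx.1]
  have hupp : (n : ℤ) * Δy - h * Δx ≤ ((n * ℓ / shearUnit n h + 1 + W : ℕ) : ℤ) * (shearUnit n h : ℤ) := by
    have hm : (n : ℤ) * (hi 1 - Y₁) + max (-(h * (lo 0 - X₁))) (-(h * (hi 0 - X₁))) ≤ ((n * ℓ / shearUnit n h + 1 + W : ℕ) : ℤ) * (shearUnit n h : ℤ) := by
      rcases max_choice (-(h * (lo 0 - X₁))) (-(h * (hi 0 - X₁))) with e | e <;> rw [e] <;> linarith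
    linarith [hhx.2]
  exact ⟨Int.le_ediv_of_mul_le hU (by linarith), Int.ediv_le_of_le_mul hU (by linarith)⟩

end Skelφ

end Transplant

end Summit.CriticalPhenomena.PercolationContinuityZ3.Theorems

end
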